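import Literature.AlgebraicGeometry.ShimuraVarieties.UnitaryShimuraCurveEmbeddingPoints
import Literature.NumberTheory.Automorphic.UnitaryGroupCongruenceDiscontinuous
import Literature.NumberTheory.Automorphic.UnitaryGroupLevelBasis
import Literature.Topology.Algebra.CompactOpenSubgroupTrace
import HarnessLib

/-!
# Finiteness of coincidence witnesses: rational elements in a compact finite-adelic coset that move one compact
# set of the ball (or of the sub-cone) into another

Topic `AlgebraicGeometry/ShimuraVarieties`, namespace `…UnitaryCanonicalModel` (continuation of ★ `UnitaryShimuraCurveEmbeddingPoints`).
THEOREMS ONLY (no definition, no named fact, no instance, no `sorry`).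

Setting: `L` a CM field (`L⁺` its maximal totally real subfield, `c` its complex conjugation), `H ∈ M₃(L)` hermitian with
frame `T ∈ GL₃(ℂ)` at the complex embedding `τ` (`Tᴴ H^τ T = diag(1,1,-1)`, so `U(H)(L⁺)` acts on the ball `𝔹²` through
`ρ = ratToU21 : γ ↦ T⁻¹ γ^τ T`) and POSITIVE DEFINITE at the complex places other than that of `τ` (`hpos`).  For a COMPACT
subgroup `K ≤ U(H)(𝔸_{L⁺,f})`, finite-adelic elements `g, g′` and COMPACT subsets of the ball (or compact sets of negative
vectors of the sub-datum `U(J⋆) ↪ U(H)`, read in the ball through the frame embedding `ι = frameEmbNeg τ B : v ↦ B^τ(v ⊕ 0)`):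

* `exists_isCongruenceSubgroup_inv_mul_mem_of_mem_coset` (§1): the rational elements `γ ∈ U(H)(L⁺)` whose finite-adelic
  image lies in the compact coset `g · K · g′⁻¹` all lie in ONE left coset `γ₀ · Γ` of a CONGRUENCE subgroup `Γ`
  (`Γ = Γ_H(K₀)` for a compact open `K₀ ⊇ g′ K g′⁻¹`, ★ `exists_isOpen_isCompact_subgroup_ge` +
  ★ `isCongruenceSubgroup_arithmeticLevel_of_le`);
* **`finite_setOf_inv_mul_mem_and_smul_mem`** (§2, BALL currency):
  `{γ ∈ U(H)(L⁺) | g⁻¹ γ_f g′ ∈ K ∧ ∃ z ∈ F₁, ρ(γ) z ∈ F₂}` is FINITE for compact `F₁, F₂ ⊆ 𝔹²` — a left translate of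
  the set of elements of the congruence subgroup `Γ` moving `F₁` into the compact `ρ(γ₀)⁻¹ F₂`, which is finite by the
  datum-free proper discontinuity ★ `finite_setOf_archRepU21_smul_mem` ([Borel1969] Prop. 7.13: arithmetic subgroups are
  discrete in `U(2,1)` and act properly on the ball);
* **`finite_setOf_witness_meeting`** (§3, CONE-VECTOR currency, the shape consumed by the injectivity assembly of the curve
  embedding `Sh_{K⋆}(U(J⋆), 𝔻) → Sh_K(U(H), 𝔹²)`): for compact `F, F′ ⊆ negCone(J⋆^τ)`,
  `{γ | g⁻¹ γ_f g′ ∈ K ∧ ∃ v ∈ F, v′ ∈ F′, c ≠ 0, ι v = c · γ^τ ι v′}` is FINITE (images of `F, F′` in the ball are compact: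
  `isCompact_image_negConeToBall_frameEmbNeg`, continuity of the dehomogenisation chart ★ `negConeBallCoord` on the cone).

WHY (cell hodgecm-mathlib, road (ii) «embedded-curve descent» of the GS-3 retirement, leaf R2-1-inj, sub-leaf (S3)
«discontinuity packaging»): in the proof that `Sh_{K⋆}(U(J⋆), 𝔻)(ℂ) → Sh_K(U(H), 𝔹²)(ℂ)` is injective for `K` small
([Deligne1971TravauxShimura] Prop. 1.15, pp. 132–133; [Milne2005ShimuraVarieties] Thm. 5.16) the coincidences of two translated
fundamental sets are witnessed by rational `γ` in a fixed compact coset moving one compact set into another — finitely many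
by this file — and the finitely many bad ones are then excluded at some finite depth (★ `CompactCosetDepth`).
HC_CM is proved only modulo the 7 printed citations until rung 0 closes; this file proves no cell binder.

## References
* [Borel1969] A. Borel, *Introduction aux groupes arithmétiques* (1969), §1 and Prop. 7.13.
* [Deligne1971TravauxShimura] P. Deligne, *Travaux de Shimura*, Sém. Bourbaki 389 (1971), Prop. 1.15 pp. 132–133.
* [Milne2005ShimuraVarieties] J. S. Milne, *Introduction to Shimura varieties* (2005), Lemma 5.13, Thm. 5.16.
* [PlatonovRapinchuk1994] V. Platonov, A. Rapinchuk, *Algebraic Groups and Number Theory* (1994), §4.1 (arithmetic and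
  congruence subgroups `G(K) ∩ K_f`), §3.3.
-/

set_option autoImplicit false

noncomputable section

open Matrix NumberField IsDedekindDomain
open scoped Matrix Pointwise Topology ComplexOrder
open Literature.Geometry.ComplexHyperbolic Literature.Geometry.ComplexHyperbolic.BallModel
open Literature.NumberTheory.Automorphic Literature.NumberTheory.Automorphic.UnitaryGroup

namespace Literature.AlgebraicGeometry.ShimuraVarieties

namespace UnitaryCanonicalModel

variable (L : Type) [Field L] [NumberField L] [IsCMField L] (H : Matrix (Fin 3) (Fin 3) L)

/-! ### §1. Rational points of a compact finite-adelic coset lie in one coset of a congruence subgroup -/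

/-- **Rational elements in a compact coset `g K g′⁻¹` form (part of) one left coset of a congruence subgroup.**  For a
COMPACT subgroup `K ≤ U(H)(𝔸_{L⁺,f})` and `g, g′`, there is a congruence subgroup `Γ ≤ U(H)(L⁺)` such that any two
rational `γ₀, γ` with `g⁻¹ (γ₀)_f g′ ∈ K` and `g⁻¹ γ_f g′ ∈ K` satisfy `γ₀⁻¹ γ ∈ Γ`.  (Indeed `(γ₀⁻¹γ)_f ∈ g′ K g′⁻¹`, a
compact subgroup, contained in a compact OPEN subgroup `K₀` by ★ `exists_isOpen_isCompact_subgroup_ge` (one compact open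
subgroup exists: the integral level); `K₀` contains a principal congruence level, so `Γ := Γ_H(K₀) = U(H)(L⁺) ∩ K₀` is a
congruence subgroup, ★ `isCongruenceSubgroup_arithmeticLevel_of_le`.) [cite: PlatonovRapinchuk1994, §4.1]
[cite: Milne2005ShimuraVarieties, Lemma 5.13 p. 57] -/
theorem exists_isCongruenceSubgroup_inv_mul_mem_of_mem_coset
    (K : Subgroup ↥(finAdelic (↥(maximalRealSubfield L)) L (IsCMField.complexConj L) 3 H))
    (hKc : IsCompact (K : Set ↥(finAdelic (↥(maximalRealSubfield L)) L (IsCMField.complexConj L) 3 H)))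
    (g g' : ↥(finAdelic (↥(maximalRealSubfield L)) L (IsCMField.complexConj L) 3 H)) :
    ∃ Γ : Subgroup (GL (Fin 3) L),
      IsCongruenceSubgroup ((IsCMField.complexConj L : L ≃ₐ[↥(maximalRealSubfield L)] L) : L →+* L) H Γ ∧
      ∀ γ₀ γ : ↥(rational (↥(maximalRealSubfield L)) L (IsCMField.complexConj L) 3 H),
        (g⁻¹ * (rationalToFinAdelic (↥(maximalRealSubfield L)) L (IsCMField.complexConj L) 3 H γ₀ * g') :
            ↥(finAdelic (↥(maximalRealSubfield L)) L (IsCMField.complexConj L) 3 H)) ∈ K →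
        (g⁻¹ * (rationalToFinAdelic (↥(maximalRealSubfield L)) L (IsCMField.complexConj L) 3 H γ * g') :
            ↥(finAdelic (↥(maximalRealSubfield L)) L (IsCMField.complexConj L) 3 H)) ∈ K →
        ((γ₀⁻¹ * γ : ↥(rational (↥(maximalRealSubfield L)) L (IsCMField.complexConj L) 3 H)) : GL (Fin 3) L) ∈ Γ := by
  -- the compact subgroup `K'' := g′ K g′⁻¹`
  let K'' : Subgroup ↥(finAdelic (↥(maximalRealSubfield L)) L (IsCMField.complexConj L) 3 H) :=
    K.map (MulAut.conj g').toMonoidHom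
  have hK''c : IsCompact (K'' : Set ↥(finAdelic (↥(maximalRealSubfield L)) L (IsCMField.complexConj L) 3 H)) := by
    have h : (K'' : Set ↥(finAdelic (↥(maximalRealSubfield L)) L (IsCMField.complexConj L) 3 H)) =
        (fun k => g' * k * g'⁻¹) '' (K : Set _) := by
      ext x
      simp only [K'', Subgroup.coe_map, Set.mem_image, SetLike.mem_coe, MulEquiv.coe_toMonoidHom, MulAut.conj_apply]
    rw [h]
    exact hKc.image ((continuous_const.mul continuous_id).mul continuous_const)
  -- one compact open subgroup: the integral level `K_{U,f}(⊤)`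
  obtain ⟨h1c, h1o⟩ := isCompact_isOpen_finCongruenceLevel_top (↥(maximalRealSubfield L)) L (IsCMField.complexConj L) 3 H
  obtain ⟨K₀, hK₀o, hK₀c, hle⟩ := Literature.Topology.Algebra.exists_isOpen_isCompact_subgroup_ge
    (finCongruenceLevel (↥(maximalRealSubfield L)) L (IsCMField.complexConj L) 3 H ⊤) K'' h1o h1c hK''c
  -- `K₀` contains a principal congruence level, so `Γ_H(K₀)` is a congruence subgroup
  obtain ⟨𝔫, h𝔫, hsub⟩ := exists_finCongruenceLevel_subset (F := ↥(maximalRealSubfield L))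
    (hK₀o.mem_nhds K₀.one_mem)
  refine ⟨arithmeticLevel (↥(maximalRealSubfield L)) L (IsCMField.complexConj L) 3 H K₀,
    isCongruenceSubgroup_arithmeticLevel_of_le hK₀c h𝔫 (fun k hk => hsub hk), fun γ₀ γ h₀ h => ?_⟩
  refine mem_arithmeticLevel_iff.2 ⟨(γ₀⁻¹ * γ).2, hle ?_⟩
  -- `(γ₀⁻¹ γ)_f = g′ · (g⁻¹ γ₀_f g′)⁻¹ · (g⁻¹ γ_f g′) · g′⁻¹ ∈ g′ K g′⁻¹`
  refine ⟨_, K.mul_mem (K.inv_mem h₀) h, ?_⟩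
  rw [MulEquiv.coe_toMonoidHom, MulAut.conj_apply, Subtype.coe_eta, map_mul, map_inv]
  group

/-! ### §2. Ball currency: finitely many rational elements of a compact coset move a compact set into a compact set -/

variable (τ : L →+* ℂ) (T : GL (Fin 3) ℂ) (hT : formCongr (starRingEnd ℂ) T (H.map τ) = BallModel.J)

/-- **Finiteness of coincidence witnesses, ball form.**  Let `H` be positive definite at the complex places other than
that of `τ` (`hpos`), `K ≤ U(H)(𝔸_{L⁺,f})` a compact subgroup, `g, g′` finite-adelic elements and `F₁, F₂ ⊆ 𝔹²` compact.
Then only FINITELY many rational `γ ∈ U(H)(L⁺)` have `g⁻¹ γ_f g′ ∈ K` and move a point of `F₁` into `F₂` through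
`ρ(γ) = T⁻¹ γ^τ T ∈ U(2,1)` (★ `ratToU21`).  Proof: such `γ` lie in a coset `γ₀ Γ` of a congruence subgroup
(`exists_isCongruenceSubgroup_inv_mul_mem_of_mem_coset`), and `δ = γ₀⁻¹ γ ∈ Γ` moves `F₁` into the compact `ρ(γ₀)⁻¹ F₂`;
these `δ` are finitely many by proper discontinuity of the arithmetic group `Γ` on the ball
(★ `finite_setOf_archRepU21_smul_mem`). [cite: Borel1969, Prop. 7.13] [cite: Milne2005ShimuraVarieties, Lemma 5.13 p. 57] -/
theorem finite_setOf_inv_mul_mem_and_smul_mem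
    (hpos : ∀ τ' : L →+* ℂ, InfinitePlace.mk τ' ≠ InfinitePlace.mk τ → (H.map τ').PosDef)
    (K : Subgroup ↥(finAdelic (↥(maximalRealSubfield L)) L (IsCMField.complexConj L) 3 H))
    (hKc : IsCompact (K : Set ↥(finAdelic (↥(maximalRealSubfield L)) L (IsCMField.complexConj L) 3 H)))
    (g g' : ↥(finAdelic (↥(maximalRealSubfield L)) L (IsCMField.complexConj L) 3 H))
    {F₁ F₂ : Set Ball} (hF₁ : IsCompact F₁) (hF₂ : IsCompact F₂) :
    {γ : ↥(rational (↥(maximalRealSubfield L)) L (IsCMField.complexConj L) 3 H) |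
      (g⁻¹ * (rationalToFinAdelic (↥(maximalRealSubfield L)) L (IsCMField.complexConj L) 3 H γ * g') :
          ↥(finAdelic (↥(maximalRealSubfield L)) L (IsCMField.complexConj L) 3 H)) ∈ K ∧
        ∃ z ∈ F₁, ratToU21 L H τ T hT γ • z ∈ F₂}.Finite := by
  classical
  set S := {γ : ↥(rational (↥(maximalRealSubfield L)) L (IsCMField.complexConj L) 3 H) |
      (g⁻¹ * (rationalToFinAdelic (↥(maximalRealSubfield L)) L (IsCMField.complexConj L) 3 H γ * g') :
          ↥(finAdelic (↥(maximalRealSubfield L)) L (IsCMField.complexConj L) 3 H)) ∈ K ∧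
        ∃ z ∈ F₁, ratToU21 L H τ T hT γ • z ∈ F₂} with hS
  rcases S.eq_empty_or_nonempty with h0 | ⟨γ₀, hγ₀⟩
  · rw [h0]; exact Set.finite_empty
  obtain ⟨Γ, hΓc, hΓ⟩ := exists_isCongruenceSubgroup_inv_mul_mem_of_mem_coset L H K hKc g g'
  -- the compact set `ρ(γ₀)⁻¹ • F₂`
  set ρ₀ : U21 := ratToU21 L H τ T hT γ₀ with hρ₀
  have hF₂' : IsCompact (ρ₀⁻¹ • F₂) := by
    rw [← Set.image_smul]
    exact hF₂.image (continuous_const_smul _)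
  -- the finite set of elements of `Γ` moving `F₁` into `ρ₀⁻¹ • F₂`
  have hfin := finite_setOf_archRepU21_smul_mem L H τ T hT hpos hΓc hF₁ hF₂'
  refine (hfin.image fun δ : ↥Γ => γ₀ * Subgroup.inclusion hΓc.le_rational δ).subset fun γ hγ => ?_
  have hmem : ((γ₀⁻¹ * γ : ↥(rational (↥(maximalRealSubfield L)) L (IsCMField.complexConj L) 3 H)) : GL (Fin 3) L) ∈ Γ :=
    hΓ γ₀ γ hγ₀.1 hγ.1
  refine ⟨⟨_, hmem⟩, ?_, ?_⟩
  · -- `δ := γ₀⁻¹ γ` moves `z ∈ F₁` into `ρ₀⁻¹ • F₂`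
    obtain ⟨z, hz, hγz⟩ := hγ.2
    refine ⟨z, hz, ?_⟩
    have hincl : Subgroup.inclusion hΓc.le_rational ⟨_, hmem⟩ = γ₀⁻¹ * γ := Subtype.ext rfl
    have hrep : archRepU21 L H τ T hT hΓc.le_rational ⟨_, hmem⟩ = ratToU21 L H τ T hT (γ₀⁻¹ * γ) := by
      rw [archRepU21_apply, hincl]
      rfl
    rw [hrep, map_mul, map_inv, mul_smul, ← hρ₀]
    exact Set.smul_mem_smul_set hγz
  · -- `γ₀ · δ = γ`
    show γ₀ * Subgroup.inclusion hΓc.le_rational ⟨_, hmem⟩ = γ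
    rw [show Subgroup.inclusion hΓc.le_rational ⟨_, hmem⟩ = γ₀⁻¹ * γ from Subtype.ext rfl, mul_inv_cancel_left]

/-! ### §3. Cone-vector currency through the frame embedding `ι = frameEmbNeg τ B` -/

section Cone

variable (Jstar : Matrix (Fin 2) (Fin 2) L) (Jperp : Matrix (Fin 1) (Fin 1) L) (B : GL (Fin 3) L) {a : L}
  (hB : formCongr ((IsCMField.complexConj L : L ≃ₐ[↥(maximalRealSubfield L)] L) : L →+* L) B (a • H) =
    finSum 2 1 Jstar Jperp)
  (hτa : 0 < (τ a).re) (hτa' : (τ a).im = 0)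

omit [NumberField L] [IsCMField L] in
/-- The frame embedding `v ↦ B^τ(v ⊕ 0)` (★ `frameEmbNeg`) is continuous. [folklore]
[cite: BergeronMillsonMoeglin2016Balls, Part 2 §1.3] -/
theorem continuous_frameEmbNeg : Continuous (frameEmbNeg τ B) := by
  unfold frameEmbNeg
  refine continuous_const.matrix_mulVec ?_
  refine continuous_pi fun i => ?_
  induction i using Fin.addCases with
  | left j => simp only [Fin.append_left]; exact continuous_apply j
  | right j => simp only [Fin.append_right]; exact continuous_const

/-- **The image in the ball of a compact set of negative vectors of the sub-datum is compact**: for compact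
`F ⊆ negCone(J⋆^τ)`, `{𝔹(B^τ(v ⊕ 0)) | v ∈ F} ⊆ 𝔹²` is compact (the dehomogenisation chart ★ `negConeBallCoord T` is continuous
on the negative cone of `H^τ`, where the last frame coordinate does not vanish, ★ `apply_two_ne_zero_of_mem_negCone`).
[cite: Milne2005ShimuraVarieties, Def. 12.5 p. 113] [cite: BergeronMillsonMoeglin2016Balls, Part 2 §1.3] -/
theorem isCompact_image_negConeToBall_frameEmbNeg {F : Set (Fin 2 → ℂ)} (hF : IsCompact F)
    (hFc : F ⊆ negCone (Jstar.map τ)) :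
    IsCompact (Set.range fun v : ↥F =>
      negConeToBall hT (frameEmbNeg_mem_negCone τ hB hτa hτa' (hFc v.2))) := by
  haveI : CompactSpace ↥F := isCompact_iff_compactSpace.mp hF
  refine isCompact_range ?_
  have hw : Continuous fun v : ↥F =>
      ((T⁻¹ : GL (Fin 3) ℂ) : Matrix (Fin 3) (Fin 3) ℂ) *ᵥ frameEmbNeg τ B (v : Fin 2 → ℂ) :=
    continuous_const.matrix_mulVec ((continuous_frameEmbNeg L τ B).comp continuous_subtype_val)
  have h2 : ∀ v : ↥F, (((T⁻¹ : GL (Fin 3) ℂ) : Matrix (Fin 3) (Fin 3) ℂ) *ᵥ frameEmbNeg τ B (v : Fin 2 → ℂ)) 2 ≠ 0 :=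
    fun v => apply_two_ne_zero_of_mem_negCone hT (frameEmbNeg_mem_negCone τ hB hτa hτa' (hFc v.2))
  unfold negConeToBall BallModel.proj
  refine Continuous.subtype_mk (continuous_pi fun i => ?_) _
  fin_cases i
  · exact ((continuous_apply 0).comp hw).div ((continuous_apply 2).comp hw) h2
  · exact ((continuous_apply 1).comp hw).div ((continuous_apply 2).comp hw) h2

include hT hB hτa hτa' in
/-- **Finiteness of coincidence witnesses, cone-vector form** (sub-leaf (S3) of the injectivity assembly for
`Sh_{K⋆}(U(J⋆), 𝔻) → Sh_K(U(H), 𝔹²)`; [Deligne1971TravauxShimura] Prop. 1.15, pp. 132–133).  Let `H` be positive definite off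
the place of `τ` (`hpos`), `F, F′` COMPACT sets of negative vectors of `J⋆^τ`, `g, g′ ∈ U(H)(𝔸_{L⁺,f})` and `K` a COMPACT
subgroup.  Then the set of rational `γ ∈ U(H)(L⁺)` with `g⁻¹ γ_f g′ ∈ K` and
`B^τ(v ⊕ 0) = c · γ^τ B^τ(v′ ⊕ 0)` for some `v ∈ F`, `v′ ∈ F′`, `c ≠ 0` (the coincidence-witness relation of
★ `ShimuraSet.mk_eq_mk_iff` read through the frame embedding) is FINITE: read in the ball, `ρ(γ)` moves the compact image of `F′`
into the compact image of `F` (★ `ratToU21_smul_negConeToBall`, ★ `negConeToBall_smul`), so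
`finite_setOf_inv_mul_mem_and_smul_mem` applies. [cite: Borel1969, Prop. 7.13]
[cite: Deligne1971TravauxShimura, Prop. 1.15 proof pp. 132–133] [cite: Milne2005ShimuraVarieties, Lemma 5.13 p. 57] -/
theorem finite_setOf_witness_meeting
    (hpos : ∀ τ' : L →+* ℂ, InfinitePlace.mk τ' ≠ InfinitePlace.mk τ → (H.map τ').PosDef)
    {F F' : Set (Fin 2 → ℂ)} (hF : IsCompact F) (hF' : IsCompact F')
    (hFc : F ⊆ negCone (Jstar.map τ)) (hF'c : F' ⊆ negCone (Jstar.map τ))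
    (g g' : ↥(finAdelic (↥(maximalRealSubfield L)) L (IsCMField.complexConj L) 3 H))
    (K : Subgroup ↥(finAdelic (↥(maximalRealSubfield L)) L (IsCMField.complexConj L) 3 H))
    (hKc : IsCompact (K : Set ↥(finAdelic (↥(maximalRealSubfield L)) L (IsCMField.complexConj L) 3 H))) :
    {γ : ↥(rational (↥(maximalRealSubfield L)) L (IsCMField.complexConj L) 3 H) |
      (g⁻¹ * (rationalToFinAdelic (↥(maximalRealSubfield L)) L (IsCMField.complexConj L) 3 H γ * g') :
          ↥(finAdelic (↥(maximalRealSubfield L)) L (IsCMField.complexConj L) 3 H)) ∈ K ∧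
        ∃ v ∈ F, ∃ v' ∈ F', ∃ c : ℂ, c ≠ 0 ∧
          frameEmbNeg τ B v =
            c • (((Matrix.GeneralLinearGroup.map τ (γ : GL (Fin 3) L) : GL (Fin 3) ℂ) : Matrix (Fin 3) (Fin 3) ℂ) *ᵥ
              frameEmbNeg τ B v')}.Finite := by
  -- the two compact images in the ball
  set F₁ : Set Ball := Set.range fun v : ↥F' =>
    negConeToBall hT (frameEmbNeg_mem_negCone τ hB hτa hτa' (hF'c v.2)) with hF₁
  set F₂ : Set Ball := Set.range fun v : ↥F =>
    negConeToBall hT (frameEmbNeg_mem_negCone τ hB hτa hτa' (hFc v.2)) with hF₂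
  have hF₁c : IsCompact F₁ := isCompact_image_negConeToBall_frameEmbNeg L H τ T hT Jstar Jperp B hB hτa hτa' hF' hF'c
  have hF₂c : IsCompact F₂ := isCompact_image_negConeToBall_frameEmbNeg L H τ T hT Jstar Jperp B hB hτa hτa' hF hFc
  refine (finite_setOf_inv_mul_mem_and_smul_mem L H τ T hT hpos K hKc g g' hF₁c hF₂c).subset fun γ hγ => ?_
  refine ⟨hγ.1, ?_⟩
  obtain ⟨v, hv, v', hv', c, hc, hball⟩ := hγ.2
  have hιv : frameEmbNeg τ B v ∈ negCone (H.map τ) := frameEmbNeg_mem_negCone τ hB hτa hτa' (hFc hv)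
  have hιv' : frameEmbNeg τ B v' ∈ negCone (H.map τ) := frameEmbNeg_mem_negCone τ hB hτa hτa' (hF'c hv')
  -- `γ^τ · ι v′ = c⁻¹ · ι v` is negative
  have hγv' : ((Matrix.GeneralLinearGroup.map τ (γ : GL (Fin 3) L) : GL (Fin 3) ℂ) : Matrix (Fin 3) (Fin 3) ℂ) *ᵥ
        frameEmbNeg τ B v' = c⁻¹ • frameEmbNeg τ B v := by
    rw [hball, smul_smul, inv_mul_cancel₀ hc, one_smul]
  have hγv'neg : ((Matrix.GeneralLinearGroup.map τ (γ : GL (Fin 3) L) : GL (Fin 3) ℂ) : Matrix (Fin 3) (Fin 3) ℂ) *ᵥ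
      frameEmbNeg τ B v' ∈ negCone (H.map τ) := by
    rw [hγv']
    exact smul_mem_negCone (inv_ne_zero hc) hιv
  refine ⟨negConeToBall hT hιv', ⟨⟨v', hv'⟩, rfl⟩, ?_⟩
  rw [ratToU21_smul_negConeToBall hT γ hιv' hγv'neg]
  -- `𝔹(γ^τ ι v′) = 𝔹(c⁻¹ ι v) = 𝔹(ι v) ∈ F₂`
  have hcv : c⁻¹ • frameEmbNeg τ B v ∈ negCone (H.map τ) := smul_mem_negCone (inv_ne_zero hc) hιv
  have hEq : negConeToBall hT hγv'neg = negConeToBall hT hιv := by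
    have h1 : negConeToBall hT hγv'neg = negConeToBall hT hcv := by
      simp only [hγv']
    rw [h1]
    exact negConeToBall_smul hT (inv_ne_zero hc) hιv hcv
  rw [hEq]
  exact ⟨⟨v, hv⟩, rfl⟩

end Cone

end UnitaryCanonicalModel

end Literature.AlgebraicGeometry.ShimuraVarieties

end
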